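/-
Copyright (c) 2026 the pub-hodgecm-mathlib formalisation cell (harness21).  Prover seat hodgecm-mathlib-K2E3-p21 (g7), HCML Track B «K2-LIT» ∕ h413
(`stmt-HodgeConjecture-24833`), line `K2_E3_EllipticInputs`, leaf (nsc-S-A′) `sig_K2E3GL3PrincipalBlockStandardSpan`, H-layer case brick C0-IRR (file 1 of 2) of the
architect's `MEMO-SA-architecture.v2.K2E3-p25-g2.md` §3 (architect K2E3-p25 (g2); dealer K2E3-plan (g4) D97).  2026-09-04.
-/
import Summits.HodgeConjecture.HodgeConjecture.Theorems.K2E3GL3JacquetMultiplicityAdditive    -- ★ ADD (p17): the `mult` currency (`normalizedJacquetGL`, `restrictUnipotentGL`) in scope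
import Literature.NumberTheory.Automorphic.ParabolicIndGLDetCharIrreducible                -- ★ `lastBlockLabel`, `maxParabolicLeviChar` (the `I₂ x y` spelling of ★ G1 ∕ H0)
import Mathlib.GroupTheory.Perm.Sign                                                      -- `Equiv.Perm.mclosure_swap_castSucc_succ` (adjacent transpositions generate `S₃`)
import HarnessLib

/-!
# Crux `H413` — leaf (nsc-S-A′), brick C0-IRR, file 1: ORBIT CONSTANCY AND PARITY OF THE JACQUET MULTIPLICITIES `mult V (tch (θ ∘ w))` UNDER THE H0 RULES
# (hypothesis-first on the architect's frozen heads `K2E3GL3ExponentRules`, FREEZE 2026-09-04 11:28:14Z; ₀₁ family ★ p859866), AND THE FIBRES OF `w ↦ θ ∘ w⁻¹`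

Cell `hodgecm-mathlib`, Track B; THEOREMS ONLY; count-neutral helper (`--supports stmt-HodgeConjecture-24833 --as helper`).  Currency (CONVENTIONS 08:40Z, MEMO v2 §0),
written inline (no definition): torus `LB 3 = Π a : Fin 3, GL {i // id i = a} F`, `tch θ = ∏ a, (θ a) ∘ det ∘ ev_a` for `θ : Fin 3 → (Fˣ →* ℂˣ)`,
`r_B V = (restrictUnipotentGL F id V).Coinvariants`, `mult V η = finrank ℂ ↥(⨅ m, maxGenEigenspace (normalizedJacquetGL F id V m) (η m))`,
`I₂ x y = parabolicIndGL F (lastBlockLabel 2) (𝟙.twist (maxParabolicLeviChar F 2 x y))` (the `GL₂` principal series `x × y`, ★ G1 spelling).  «`x, y` NOT LINKED» enters ONLY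
as the hypothesis `(I₂ x y).IsIrreducible` (dischargeable by ★ GL2-UNL `isIrreducible_parabolicIndGL_two_of_not_linked` ∕ `_two_self`), exactly as in the H0 heads.

THE MATHEMATICS ([BernsteinZelevinsky1977, Thm. 2.9, §2.3]; [Casselman1995, §6.4]; the `n = 3` exponent calculus):
* §1 (combinatorics of `Fin 3 → α`): a NON-CONSTANT triple has a «lonely» index `k` (`θ i = θ k → i = k`); the fibre `{w : θ ∘ w₀⁻¹ = θ ∘ w⁻¹}` lies in `{w : w k = w₀ k}`,
  which has two elements (`decide`), so it has `≤ 2` elements (`card_filter_comp_perm_symm_eq_le_two`), and `≤ 1` for pairwise distinct letters (`…_le_one`);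
  spelled with `w.symm` exactly as in ★ H0-a's exponent count `mult (I θ) η = #{w : η = tch (θ ∘ w⁻¹)}`.
* §2 H0 HYPOTHESIS-FIRST (the three weakest frozen heads, ∀-closed over `{X} (V) (hV) [fd] (x y z) (hx hy hz)`): `hL₀₁` «`mult V (tch (x,y,z)) ≤ mult V (tch (y,x,z))` if
  `I₂ x y` is irreducible», `hL₁₂` (positions 1, 2) and `hP₀₁` «`mult V (tch (x,x,z))` is even if `I₂ x x` is irreducible».  When ALL ordered pairs of letters of `θ` give an
  irreducible `I₂`, the adjacent transpositions act both ways and generate `S₃` (Mathlib `Equiv.Perm.mclosure_swap_castSucc_succ`): **`finrank_weightSpace_tch_comp_perm`**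
  `mult V (tch (θ ∘ w)) = mult V (tch θ)` for every `w`, and at a coincidence `θ i = θ j` (`i ≠ j`) the common value is EVEN (**`even_finrank_weightSpace_tch_of_apply_eq`**:
  move the equal letters to positions `0, 1` and apply `hP₀₁`).  Consumer: file 2 `K2E3GL3PrincipalSeriesIrreducibleUnlinked` (C0-IRR main theorem).

HONEST LABEL: HC_CM is proved only modulo the 7 printed citations (2 remaining named inputs: hLiu418 = stmt-HodgeConjecture-24832, h413 = stmt-HodgeConjecture-24833) until
rung 0 closes; count-neutral helper, closes no socket; §2 is CONDITIONAL on the H0 binders (stated as hypotheses, not assumed as facts).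

## Mathlib ∕ tree search
Tree ★: ADD `K2E3GL3JacquetMultiplicityAdditive` (currency only) · `Zelevinsky1980.lastBlockLabel ∕ maxParabolicLeviChar`.  Mathlib: `Equiv.Perm.mclosure_swap_castSucc_succ`, `Submonoid.closure_induction`,
`Equiv.swap_apply_left ∕ _right ∕ _self ∕ _of_ne_of_ne`, `Finset.card_le_card`, `Finset.card_le_one`, `Function.Injective.ne`.  Dedup: `lean search 'tch_comp_perm|lonely_index|filter_perm_apply'` — none.

## References
* [BernsteinZelevinsky1977] I. N. Bernstein, A. V. Zelevinsky, *Induced representations of reductive p-adic groups I*, Ann. Sci. ÉNS 10 (1977), Thm. 2.9, Cor. 2.13, §2.3.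
* [Casselman1995] W. Casselman, *Introduction to the theory of admissible representations of p-adic reductive groups* (draft 1995), §6.3 (Thm. 6.3.5), §6.4.
-/

set_option autoImplicit false
-- the mandated namespace repeats `HodgeConjecture.HodgeConjecture`, as in every `Theorems/*.lean` of this sub-problem
set_option linter.dupNamespace false

noncomputable section

open Representation Module Function Equiv Literature.NumberTheory.Automorphic Literature.NumberTheory.Automorphic.Zelevinsky1980
open Literature.NumberTheory.GaloisRepresentations.IsNonarchimedeanLocalField Literature.RepresentationTheory.FiniteGroups
open scoped MatrixGroups
open Summit.HodgeConjecture.HodgeConjecture.Cruxes.H413.K2E3GL3JacquetMultiplicityAdditive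

namespace Summit.HodgeConjecture.HodgeConjecture.Cruxes.H413.K2E3GL3WeightOrbitConstancy

/-! ## §1 The fibres of `w ↦ θ ∘ w⁻¹` on triples -/

section Algebra

/-- A triple which is NOT CONSTANT has a «lonely» index `k`: `θ i = θ k → i = k`. [folklore] -/
theorem exists_lonely_index {α : Type*} (θ : Fin 3 → α) (hne : ¬ (θ 0 = θ 1 ∧ θ 1 = θ 2)) : ∃ k : Fin 3, ∀ i, θ i = θ k → i = k := by
  by_cases h01 : θ 0 = θ 1
  · have h12 : θ 1 ≠ θ 2 := fun h => hne ⟨h01, h⟩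
    refine ⟨2, fun i hi => ?_⟩
    fin_cases i
    · exact absurd (h01.symm.trans hi) h12
    · exact absurd hi h12
    · rfl
  · by_cases h02 : θ 0 = θ 2
    · refine ⟨1, fun i hi => ?_⟩
      fin_cases i
      · exact absurd hi h01
      · rfl
      · exact absurd (h02.trans hi) h01
    · refine ⟨0, fun i hi => ?_⟩
      fin_cases i
      · rfl
      · exact absurd hi.symm h01
      · exact absurd hi.symm h02

/-- In `S₃`, exactly two permutations send a given `k` to a given `j`. [folklore] -/
theorem card_filter_perm_apply_eq (k j : Fin 3) : ((Finset.univ : Finset (Equiv.Perm (Fin 3))).filter fun w : Equiv.Perm (Fin 3) => w k = j).card = 2 := by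
  revert k j
  decide

/-- **The fibres of `w ↦ θ ∘ w⁻¹` have at most two elements when `θ` is not constant** (they lie in `{w : w k = w₀ k}` for a lonely index `k`);
stated in the `w.symm` spelling of ★ H0-a's exponent count. [folklore] -/
theorem card_filter_comp_perm_symm_eq_le_two {α : Type*} (θ : Fin 3 → α) (hne : ¬ (θ 0 = θ 1 ∧ θ 1 = θ 2)) (w₀ : Equiv.Perm (Fin 3))
    [DecidablePred fun w : Equiv.Perm (Fin 3) => (fun a => θ (w₀.symm a)) = fun a => θ (w.symm a)] :
    ((Finset.univ : Finset (Equiv.Perm (Fin 3))).filter fun w : Equiv.Perm (Fin 3) => (fun a => θ (w₀.symm a)) = fun a => θ (w.symm a)).card ≤ 2 := by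
  obtain ⟨k, hk⟩ := exists_lonely_index θ hne
  refine (Finset.card_le_card fun w hw => ?_).trans (card_filter_perm_apply_eq k (w₀ k)).le
  rw [Finset.mem_filter] at hw ⊢
  refine ⟨hw.1, ?_⟩
  have h := congrFun hw.2 (w₀ k)
  rw [Equiv.symm_apply_apply] at h
  have hk' := hk _ h.symm
  calc w k = w (w.symm (w₀ k)) := by rw [hk']
    _ = w₀ k := w.apply_symm_apply _

/-- **… and at most one element when the letters are pairwise distinct.** [folklore] -/
theorem card_filter_comp_perm_symm_eq_le_one {α : Type*} (θ : Fin 3 → α) (hinj : Function.Injective θ) (w₀ : Equiv.Perm (Fin 3))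
    [DecidablePred fun w : Equiv.Perm (Fin 3) => (fun a => θ (w₀.symm a)) = fun a => θ (w.symm a)] :
    ((Finset.univ : Finset (Equiv.Perm (Fin 3))).filter fun w : Equiv.Perm (Fin 3) => (fun a => θ (w₀.symm a)) = fun a => θ (w.symm a)).card ≤ 1 := by
  refine Finset.card_le_one.2 fun w hw w' hw' => ?_
  rw [Finset.mem_filter] at hw hw'
  have h : (fun a => θ (w.symm a)) = fun a => θ (w'.symm a) := hw.2.symm.trans hw'.2
  have hs : w.symm = w'.symm := Equiv.ext fun a => hinj (congrFun h a)
  simpa using congrArg Equiv.symm hs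

end Algebra


/-! ## §2 Orbit constancy and parity of `mult V (tch θ)` under the H0 heads (hypothesis-first) -/

section Orbit

variable {F : Type} [Field F] [ValuativeRel F] [TopologicalSpace F] [IsNonarchimedeanLocalField F]

/-- Rearranging a triple: `θ ∘ w = ![θ (w 0), θ (w 1), θ (w 2)]`. [folklore] -/
theorem comp_perm_eq_vec {α : Type*} (θ : Fin 3 → α) (w : Equiv.Perm (Fin 3)) : (fun a => θ (w a)) = ![θ (w 0), θ (w 1), θ (w 2)] := by
  funext i; fin_cases i <;> rfl

set_option maxHeartbeats 400000 in
/-- **ORBIT CONSTANCY.**  Let `V` be a smooth representation of `GL₃(F)` with `r_B V` finite-dimensional, `θ` a triple of characters with open kernels ALL of whose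
ordered pairs give an irreducible `I₂ (θ i) (θ j)` (`i ≠ j`; «no two letters linked»).  Under the frozen H0 heads `hL₀₁`, `hL₁₂` (hypothesis-first):
`mult V (tch (θ ∘ w)) = mult V (tch θ)` for every `w ∈ S₃` — the two adjacent transpositions act in both directions and generate `S₃`
(Mathlib `Equiv.Perm.mclosure_swap_castSucc_succ`). [cite: BernsteinZelevinsky1977, Thm. 2.9, §2.3] [cite: Casselman1995, §6.4] -/
theorem finrank_weightSpace_tch_comp_perm
    (hL₀₁ : ∀ {X : Type} [AddCommGroup X] [Module ℂ X] (V : Representation ℂ (GL (Fin 3) F) X), V.IsSmooth →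
      ∀ [FiniteDimensional ℂ (restrictUnipotentGL F (id : Fin 3 → Fin 3) V).Coinvariants] (x y z : Fˣ →* ℂˣ),
      IsOpen (x.ker : Set Fˣ) → IsOpen (y.ker : Set Fˣ) → IsOpen (z.ker : Set Fˣ) →
      (Representation.parabolicIndGL F (lastBlockLabel 2) ((Representation.trivial ℂ (Π a : Bool, GL {i : Fin 2 // lastBlockLabel 2 i = a} F) ℂ).twist (maxParabolicLeviChar F 2 x y))).IsIrreducible →
      finrank ℂ ↥(⨅ m, Module.End.maxGenEigenspace (normalizedJacquetGL F (id : Fin 3 → Fin 3) V m)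
          (((∏ a : Fin 3, ((![x, y, z] : Fin 3 → (Fˣ →* ℂˣ)) a).comp (Matrix.GeneralLinearGroup.det.comp (Pi.evalMonoidHom (fun a : Fin 3 => GL {i : Fin 3 // (id : Fin 3 → Fin 3) i = a} F) a))) m : ℂˣ) : ℂ)) ≤
        finrank ℂ ↥(⨅ m, Module.End.maxGenEigenspace (normalizedJacquetGL F (id : Fin 3 → Fin 3) V m)
          (((∏ a : Fin 3, ((![y, x, z] : Fin 3 → (Fˣ →* ℂˣ)) a).comp (Matrix.GeneralLinearGroup.det.comp (Pi.evalMonoidHom (fun a : Fin 3 => GL {i : Fin 3 // (id : Fin 3 → Fin 3) i = a} F) a))) m : ℂˣ) : ℂ)))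
    (hL₁₂ : ∀ {X : Type} [AddCommGroup X] [Module ℂ X] (V : Representation ℂ (GL (Fin 3) F) X), V.IsSmooth →
      ∀ [FiniteDimensional ℂ (restrictUnipotentGL F (id : Fin 3 → Fin 3) V).Coinvariants] (x y z : Fˣ →* ℂˣ),
      IsOpen (x.ker : Set Fˣ) → IsOpen (y.ker : Set Fˣ) → IsOpen (z.ker : Set Fˣ) →
      (Representation.parabolicIndGL F (lastBlockLabel 2) ((Representation.trivial ℂ (Π a : Bool, GL {i : Fin 2 // lastBlockLabel 2 i = a} F) ℂ).twist (maxParabolicLeviChar F 2 y z))).IsIrreducible →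
      finrank ℂ ↥(⨅ m, Module.End.maxGenEigenspace (normalizedJacquetGL F (id : Fin 3 → Fin 3) V m)
          (((∏ a : Fin 3, ((![x, y, z] : Fin 3 → (Fˣ →* ℂˣ)) a).comp (Matrix.GeneralLinearGroup.det.comp (Pi.evalMonoidHom (fun a : Fin 3 => GL {i : Fin 3 // (id : Fin 3 → Fin 3) i = a} F) a))) m : ℂˣ) : ℂ)) ≤
        finrank ℂ ↥(⨅ m, Module.End.maxGenEigenspace (normalizedJacquetGL F (id : Fin 3 → Fin 3) V m)
          (((∏ a : Fin 3, ((![x, z, y] : Fin 3 → (Fˣ →* ℂˣ)) a).comp (Matrix.GeneralLinearGroup.det.comp (Pi.evalMonoidHom (fun a : Fin 3 => GL {i : Fin 3 // (id : Fin 3 → Fin 3) i = a} F) a))) m : ℂˣ) : ℂ)))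
    {X : Type} [AddCommGroup X] [Module ℂ X] (V : Representation ℂ (GL (Fin 3) F) X) (hV : V.IsSmooth)
    [FiniteDimensional ℂ (restrictUnipotentGL F (id : Fin 3 → Fin 3) V).Coinvariants]
    (θ : Fin 3 → (Fˣ →* ℂˣ)) (hθ : ∀ a, IsOpen ((θ a).ker : Set Fˣ))
    (hunl : ∀ i j : Fin 3, i ≠ j →
      (Representation.parabolicIndGL F (lastBlockLabel 2) ((Representation.trivial ℂ (Π a : Bool, GL {i : Fin 2 // lastBlockLabel 2 i = a} F) ℂ).twist (maxParabolicLeviChar F 2 (θ i) (θ j)))).IsIrreducible)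
    (w : Equiv.Perm (Fin 3)) :
    finrank ℂ ↥(⨅ m, Module.End.maxGenEigenspace (normalizedJacquetGL F (id : Fin 3 → Fin 3) V m)
        (((∏ a : Fin 3, ((fun a => θ (w a)) a).comp (Matrix.GeneralLinearGroup.det.comp (Pi.evalMonoidHom (fun a : Fin 3 => GL {i : Fin 3 // (id : Fin 3 → Fin 3) i = a} F) a))) m : ℂˣ) : ℂ)) =
      finrank ℂ ↥(⨅ m, Module.End.maxGenEigenspace (normalizedJacquetGL F (id : Fin 3 → Fin 3) V m)
        (((∏ a : Fin 3, (θ a).comp (Matrix.GeneralLinearGroup.det.comp (Pi.evalMonoidHom (fun a : Fin 3 => GL {i : Fin 3 // (id : Fin 3 → Fin 3) i = a} F) a))) m : ℂˣ) : ℂ)) := by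
  -- generalise over `θ`: the inductive predicate along the generation of `S₃` by the adjacent transpositions
  have hmem : w ∈ Submonoid.closure (Set.range fun i : Fin 2 => Equiv.swap i.castSucc i.succ) := by
    rw [Equiv.Perm.mclosure_swap_castSucc_succ]; exact Submonoid.mem_top w
  revert θ
  induction hmem using Submonoid.closure_induction with
  | one =>
    intro θ _ _
    rfl
  | mul u v _ _ ihu ihv =>
    intro θ hθ hunl
    -- `θ ∘ (u v) = (θ ∘ u) ∘ v`
    have h1 := ihv (fun a => θ (u a)) (fun a => hθ (u a)) (fun i j hij => hunl (u i) (u j) (u.injective.ne hij))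
    simp only [Equiv.Perm.coe_mul, Function.comp_apply] at h1 ⊢
    exact h1.trans (ihu θ hθ hunl)
  | mem s hs =>
    intro θ hθ hunl
    obtain ⟨i, hi⟩ := hs
    have hs' : s = Equiv.swap (0 : Fin 3) 1 ∨ s = Equiv.swap (1 : Fin 3) 2 := by
      rw [← hi]; fin_cases i
      · exact Or.inl (by decide)
      · exact Or.inr (by decide)
    -- write `θ = ![x, y, z]`
    obtain ⟨x, y, z, rfl⟩ : ∃ x y z : Fˣ →* ℂˣ, θ = ![x, y, z] := ⟨θ 0, θ 1, θ 2, by funext i; fin_cases i <;> rfl⟩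
    have hx : IsOpen (x.ker : Set Fˣ) := hθ 0
    have hy : IsOpen (y.ker : Set Fˣ) := hθ 1
    have hz : IsOpen (z.ker : Set Fˣ) := hθ 2
    rcases hs' with rfl | rfl
    · -- the transposition `(0 1)`
      have hs : (fun a => (![x, y, z] : Fin 3 → (Fˣ →* ℂˣ)) (Equiv.swap (0 : Fin 3) 1 a)) = ![y, x, z] := by
        funext a; fin_cases a <;> simp [Equiv.swap_apply_of_ne_of_ne]
      rw [hs]
      exact le_antisymm (hL₀₁ V hV y x z hy hx hz (hunl 1 0 (by decide))) (hL₀₁ V hV x y z hx hy hz (hunl 0 1 (by decide)))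
    · -- the transposition `(1 2)`
      have hs : (fun a => (![x, y, z] : Fin 3 → (Fˣ →* ℂˣ)) (Equiv.swap (1 : Fin 3) 2 a)) = ![x, z, y] := by
        funext a; fin_cases a <;> simp [Equiv.swap_apply_of_ne_of_ne]
      rw [hs]
      exact le_antisymm (hL₁₂ V hV x z y hx hz hy (hunl 2 1 (by decide))) (hL₁₂ V hV x y z hx hy hz (hunl 1 2 (by decide)))

set_option maxHeartbeats 400000 in
/-- **PARITY AT A COINCIDENCE.**  In the situation of `finrank_weightSpace_tch_comp_perm`, and under the frozen H0 parity head `hP₀₁` (hypothesis-first):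
if `θ i = θ j` for some `i ≠ j`, then `mult V (tch θ)` is EVEN — move the two equal letters to positions `0, 1` by orbit constancy and apply `hP₀₁`.
[cite: BernsteinZelevinsky1977, Thm. 2.9, §2.3] [cite: Casselman1995, §6.4] -/
theorem even_finrank_weightSpace_tch_of_apply_eq
    (hL₀₁ : ∀ {X : Type} [AddCommGroup X] [Module ℂ X] (V : Representation ℂ (GL (Fin 3) F) X), V.IsSmooth →
      ∀ [FiniteDimensional ℂ (restrictUnipotentGL F (id : Fin 3 → Fin 3) V).Coinvariants] (x y z : Fˣ →* ℂˣ),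
      IsOpen (x.ker : Set Fˣ) → IsOpen (y.ker : Set Fˣ) → IsOpen (z.ker : Set Fˣ) →
      (Representation.parabolicIndGL F (lastBlockLabel 2) ((Representation.trivial ℂ (Π a : Bool, GL {i : Fin 2 // lastBlockLabel 2 i = a} F) ℂ).twist (maxParabolicLeviChar F 2 x y))).IsIrreducible →
      finrank ℂ ↥(⨅ m, Module.End.maxGenEigenspace (normalizedJacquetGL F (id : Fin 3 → Fin 3) V m)
          (((∏ a : Fin 3, ((![x, y, z] : Fin 3 → (Fˣ →* ℂˣ)) a).comp (Matrix.GeneralLinearGroup.det.comp (Pi.evalMonoidHom (fun a : Fin 3 => GL {i : Fin 3 // (id : Fin 3 → Fin 3) i = a} F) a))) m : ℂˣ) : ℂ)) ≤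
        finrank ℂ ↥(⨅ m, Module.End.maxGenEigenspace (normalizedJacquetGL F (id : Fin 3 → Fin 3) V m)
          (((∏ a : Fin 3, ((![y, x, z] : Fin 3 → (Fˣ →* ℂˣ)) a).comp (Matrix.GeneralLinearGroup.det.comp (Pi.evalMonoidHom (fun a : Fin 3 => GL {i : Fin 3 // (id : Fin 3 → Fin 3) i = a} F) a))) m : ℂˣ) : ℂ)))
    (hL₁₂ : ∀ {X : Type} [AddCommGroup X] [Module ℂ X] (V : Representation ℂ (GL (Fin 3) F) X), V.IsSmooth →
      ∀ [FiniteDimensional ℂ (restrictUnipotentGL F (id : Fin 3 → Fin 3) V).Coinvariants] (x y z : Fˣ →* ℂˣ),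
      IsOpen (x.ker : Set Fˣ) → IsOpen (y.ker : Set Fˣ) → IsOpen (z.ker : Set Fˣ) →
      (Representation.parabolicIndGL F (lastBlockLabel 2) ((Representation.trivial ℂ (Π a : Bool, GL {i : Fin 2 // lastBlockLabel 2 i = a} F) ℂ).twist (maxParabolicLeviChar F 2 y z))).IsIrreducible →
      finrank ℂ ↥(⨅ m, Module.End.maxGenEigenspace (normalizedJacquetGL F (id : Fin 3 → Fin 3) V m)
          (((∏ a : Fin 3, ((![x, y, z] : Fin 3 → (Fˣ →* ℂˣ)) a).comp (Matrix.GeneralLinearGroup.det.comp (Pi.evalMonoidHom (fun a : Fin 3 => GL {i : Fin 3 // (id : Fin 3 → Fin 3) i = a} F) a))) m : ℂˣ) : ℂ)) ≤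
        finrank ℂ ↥(⨅ m, Module.End.maxGenEigenspace (normalizedJacquetGL F (id : Fin 3 → Fin 3) V m)
          (((∏ a : Fin 3, ((![x, z, y] : Fin 3 → (Fˣ →* ℂˣ)) a).comp (Matrix.GeneralLinearGroup.det.comp (Pi.evalMonoidHom (fun a : Fin 3 => GL {i : Fin 3 // (id : Fin 3 → Fin 3) i = a} F) a))) m : ℂˣ) : ℂ)))
    (hP₀₁ : ∀ {X : Type} [AddCommGroup X] [Module ℂ X] (V : Representation ℂ (GL (Fin 3) F) X), V.IsSmooth →
      ∀ [FiniteDimensional ℂ (restrictUnipotentGL F (id : Fin 3 → Fin 3) V).Coinvariants] (x z : Fˣ →* ℂˣ),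
      IsOpen (x.ker : Set Fˣ) → IsOpen (z.ker : Set Fˣ) →
      (Representation.parabolicIndGL F (lastBlockLabel 2) ((Representation.trivial ℂ (Π a : Bool, GL {i : Fin 2 // lastBlockLabel 2 i = a} F) ℂ).twist (maxParabolicLeviChar F 2 x x))).IsIrreducible →
      Even (finrank ℂ ↥(⨅ m, Module.End.maxGenEigenspace (normalizedJacquetGL F (id : Fin 3 → Fin 3) V m)
          (((∏ a : Fin 3, ((![x, x, z] : Fin 3 → (Fˣ →* ℂˣ)) a).comp (Matrix.GeneralLinearGroup.det.comp (Pi.evalMonoidHom (fun a : Fin 3 => GL {i : Fin 3 // (id : Fin 3 → Fin 3) i = a} F) a))) m : ℂˣ) : ℂ))))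
    {X : Type} [AddCommGroup X] [Module ℂ X] (V : Representation ℂ (GL (Fin 3) F) X) (hV : V.IsSmooth)
    [FiniteDimensional ℂ (restrictUnipotentGL F (id : Fin 3 → Fin 3) V).Coinvariants]
    (θ : Fin 3 → (Fˣ →* ℂˣ)) (hθ : ∀ a, IsOpen ((θ a).ker : Set Fˣ))
    (hunl : ∀ i j : Fin 3, i ≠ j →
      (Representation.parabolicIndGL F (lastBlockLabel 2) ((Representation.trivial ℂ (Π a : Bool, GL {i : Fin 2 // lastBlockLabel 2 i = a} F) ℂ).twist (maxParabolicLeviChar F 2 (θ i) (θ j)))).IsIrreducible)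
    {i j : Fin 3} (hij : i ≠ j) (he : θ i = θ j) :
    Even (finrank ℂ ↥(⨅ m, Module.End.maxGenEigenspace (normalizedJacquetGL F (id : Fin 3 → Fin 3) V m)
        (((∏ a : Fin 3, (θ a).comp (Matrix.GeneralLinearGroup.det.comp (Pi.evalMonoidHom (fun a : Fin 3 => GL {i : Fin 3 // (id : Fin 3 → Fin 3) i = a} F) a))) m : ℂˣ) : ℂ))) := by
  -- the key step: a rearrangement `θ ∘ σ` with equal letters at positions `0, 1`
  have key : ∀ σ : Equiv.Perm (Fin 3), θ (σ 0) = θ (σ 1) →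
      Even (finrank ℂ ↥(⨅ m, Module.End.maxGenEigenspace (normalizedJacquetGL F (id : Fin 3 → Fin 3) V m)
        (((∏ a : Fin 3, (θ a).comp (Matrix.GeneralLinearGroup.det.comp (Pi.evalMonoidHom (fun a : Fin 3 => GL {i : Fin 3 // (id : Fin 3 → Fin 3) i = a} F) a))) m : ℂˣ) : ℂ))) := by
    intro σ hσ
    rw [← finrank_weightSpace_tch_comp_perm hL₀₁ hL₁₂ V hV θ hθ hunl σ, comp_perm_eq_vec θ σ, ← hσ]
    have h01 : σ 0 ≠ σ 1 := σ.injective.ne (by decide)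
    have hirr := hunl (σ 0) (σ 1) h01
    rw [← hσ] at hirr
    exact hP₀₁ V hV (θ (σ 0)) (θ (σ 2)) (hθ _) (hθ _) hirr
  -- a permutation `σ` with `σ 0 = i`, `σ 1 = j`
  have hj : Equiv.swap (0 : Fin 3) i j ≠ 0 := fun h =>
    hij (((Equiv.swap (0 : Fin 3) i).injective (h.trans (Equiv.swap_apply_right _ _).symm)).symm)
  refine key (Equiv.swap 0 i * Equiv.swap 1 (Equiv.swap 0 i j)) ?_
  rw [Equiv.Perm.coe_mul, Function.comp_apply, Function.comp_apply,
    Equiv.swap_apply_of_ne_of_ne (a := (1 : Fin 3)) (b := Equiv.swap (0 : Fin 3) i j) (x := (0 : Fin 3)) (by decide) hj.symm,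
    Equiv.swap_apply_left, Equiv.swap_apply_left, Equiv.swap_apply_self]
  exact he

end Orbit


end Summit.HodgeConjecture.HodgeConjecture.Cruxes.H413.K2E3GL3WeightOrbitConstancy

end
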